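import Summits.ResolutionOfSingularities.ResolutionOfSingularities.Theorems.PurelyInseparableDim4SwapTransportWindowPlayPrime
import Summits.ResolutionOfSingularities.ResolutionOfSingularities.Theorems.PurelyInseparableDim4SwapTransportWindowResidual
import HarnessLib
import HarnessLib.Audit.Tags

/-!
# Purely inseparable four-folds — THE VIRTUAL WINDOW FROM A SATELLITE ENTRY, FOR EVERY PRIME `p`: the recursion data, a common
# isolation certificate, and the light-pair power-cone killer with rotations MODULO THE ENTRY (cell `res-dim4-pi`, K2(p) lane,
# rung-1 POWER-CONE LINE «light pair of TAIL(p, p−1, 3) ∀ p», window half W6a; the `p = 5` instance is res-dim4-typ-1 g3's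
# `…SwapTransportWindowResidual` p702286)

[OURS · counted 0 · cell `res-dim4-pi` · K2(p) lane (holder res-dim4-p-12 g5, rulings g5-2 (6) / g5-6) · seat res-dim4-typ-1 g5.]
Nothing here proves K2(p) for any `p`, any TAIL(p, p−1, 3), any TAIL(7, d, e), `NoIsolatedTrap p p` or resolution of singularities
in dimension ≥ 4 / characteristic `p` — NOT proved.  AI kernel work, weaker than expert review.  The light-pair power-cone sub-row
is here reduced to ONE hypothesis `hE` (the ENTRY: beyond every index some real time carries a framed virtual partner for every
precision and jet — res-dim4-p-3's port of `exists_cInf_virtual_entry_rel/_of_rotation`, not in this file).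

* §1 `exists_virtual_data_prime (q)` — the virtual charts / bijections / states `(ℓs, πs, Bs)` generated from an entry `(π₀, B₀)`
  by the recursion rule of W5 `virtual_step_any_prime` EXIST (plain `Nat.rec`; no `def`).
* §2 `exists_common_cert_prime (q)` — a finite window of isolated states has a common certificate level (`cert_mono` is the
  `p = 5` file's, p-free).
* §3 **`virtual_window_false_at_prime`** — an entry at a real time `k` whose step re-creates the slot `π₀ λ` (slot step in the chart
  `π₀ λ`, or rotation translating `π₀ λ` away) and whose NEXT step is SATELLITE (`FreeTail.IsSatellite j b k`) feeds W5b
  `virtual_window_false_of_entry_prime` (`ℓs 0 = λ`, `ℓs 1 = μ` are read off the recursion rule); window `T ≥ 4(d − 1) + 2`.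
* §4 **`cInf_no_chain_of_entry_prime`** — an isolated above-floor `Step0 p` chain with `x^{r₀} ∣ F₀`, shade `d` (`d + 1 = p`,
  `2 ≤ d`) and `e_G = 3` from `k₀`, weights `≤ 1` of total `2`, witnessed with rotations ALLOWED, is impossible MODULO THE ENTRY
  `hE`: free-tail lemma (`FreeTailProof.noIsolatedFreeTailAt_self (p)`) for a satellite time `s ≥ k`, W5a `virtual_iterate_prime` to
  `s`, `virtual_window_false_at_prime` at `s`.
DICTIONARY against `5`: `Step0 5 ↦ Step0 p`, `ordZero ≠ 5 ↦ ≠ p`, shade `4 ↦ d`, `6 ↦ d + 2`, `x_f⁴ ↦ x_f^d`, `e_f ≤ 3 ↦ ≤ d − 1`,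
dead «ū²» ↦ ROW `(eu, ef)` with `eu + ef = d − 2` (chosen by the entry; the line owner's GO on Q-FLAG, bus 2026-08-29 10:50Z), flag
`3u ↦ (eu+1)u + ef·f`, window `9 ↦ T + 1` with `T ≥ 4(d−1) + 2`, budgets `Nc + 57 ↦ Nc + 2p + 2 + p(T+1)`,
`48 ↦ d + 4 + d(T+1)`.
[cite: Hauser2010, §§F–G] [cite: CossartJannsenSaito2020, Thm. 3.14]
bears_on: LADDER-RESOLUTION:D157-DOOR2 (res-dim4-pi · K2(p) · power cones · virtual window residual ∀ p).  Supports
stmt-ResolutionOfSingularities-16155 (helper).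
-/

set_option linter.dupNamespace false -- mandated namespace of this single-conjunct summit

noncomputable section

namespace Summit.ResolutionOfSingularities.ResolutionOfSingularities.Theorems.PIDim4

namespace SwapTransport

open MvPolynomial Finset
open Literature.AlgebraicGeometry.Resolution
open Literature.AlgebraicGeometry.Resolution.CentreBlowup
open Literature.AlgebraicGeometry.Resolution.Hauser2010
open Literature.AlgebraicGeometry.Resolution.HauserPerlega2019

variable {K : Type} [Field K] [DecidableEq K]

/-! ## §1 The recursion data exist, any exponent -/

/-- The virtual data generated by the recursion rule from an entry `(π₀, B₀)`, for `Step q`. [OURS · bookkeeping] -/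
theorem exists_virtual_data_prime (q : ℕ) (j : ℕ → Fin 4) (b : ℕ → Fin 4 → K) (k : ℕ) (la mu : Fin 4)
    (π₀ : Equiv.Perm (Fin 4)) (B₀ : State K) :
    ∃ (πs : ℕ → Equiv.Perm (Fin 4)) (Bs : ℕ → State K) (ℓs : ℕ → Fin 4), πs 0 = π₀ ∧ Bs 0 = B₀ ∧
      (∀ t, Bs (t + 1) = CentreBlowup.step q Finset.univ (ℓs t) 0 (Bs t)) ∧
      (∀ t, ℓs t = if j (k + t) = πs t la then la else if j (k + t) = πs t mu then mu
        else if b (k + t) (πs t la) ≠ 0 then la else mu) ∧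
      (∀ t, πs (t + 1) = if j (k + t) = πs t la ∨ j (k + t) = πs t mu then πs t
        else (Equiv.swap (ℓs t) ((πs t).symm (j (k + t)))).trans (πs t)) := by
  let Φ : ℕ → Equiv.Perm (Fin 4) × State K := fun t => Nat.rec (π₀, B₀) (fun t q' =>
    ((if j (k + t) = q'.1 la ∨ j (k + t) = q'.1 mu then q'.1 else
        (Equiv.swap (if j (k + t) = q'.1 la then la else if j (k + t) = q'.1 mu then mu
          else if b (k + t) (q'.1 la) ≠ 0 then la else mu) (q'.1.symm (j (k + t)))).trans q'.1),
      CentreBlowup.step q Finset.univ (if j (k + t) = q'.1 la then la else if j (k + t) = q'.1 mu then mu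
          else if b (k + t) (q'.1 la) ≠ 0 then la else mu) 0 q'.2)) t
  refine ⟨fun t => (Φ t).1, fun t => (Φ t).2, fun t => if j (k + t) = (Φ t).1 la then la else if j (k + t) = (Φ t).1 mu then mu
    else if b (k + t) ((Φ t).1 la) ≠ 0 then la else mu, rfl, rfl, fun t => rfl, fun t => rfl, fun t => rfl⟩

/-! ## §2 A common isolation certificate, any exponent -/

omit [DecidableEq K] in
/-- A finite window of `q`-isolated states has a common certificate level. [folklore] -/
theorem exists_common_cert_prime (q : ℕ) {c : ℕ → State K} {k T : ℕ} (hiso : ∀ t, t ≤ T → IsIsolated q (c (k + t)).F) :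
    ∃ Nc : ℕ, ∀ t, t ≤ T → originIdeal K ^ Nc ≤ singLocusIdeal q (c (k + t)).F ⊔ originIdeal K ^ (Nc + 1) := by
  induction T with
  | zero =>
    obtain ⟨N, hN⟩ := IsolationConverse.exists_certificate_of_isIsolated (hiso 0 le_rfl)
    exact ⟨N, fun t ht => by obtain rfl : t = 0 := Nat.le_zero.mp ht; exact hN⟩
  | succ T ih =>
    obtain ⟨N₁, hN₁⟩ := ih fun t ht => hiso t (Nat.le_succ_of_le ht)
    obtain ⟨N₂, hN₂⟩ := IsolationConverse.exists_certificate_of_isIsolated (hiso (T + 1) le_rfl)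
    refine ⟨max N₁ N₂, fun t ht => ?_⟩
    rcases Nat.lt_or_ge t (T + 1) with hlt | hge
    · exact cert_mono (hN₁ t (by omega)) (le_max_left _ _)
    · obtain rfl : t = T + 1 := le_antisymm ht hge
      exact cert_mono hN₂ (le_max_right _ _)

/-! ## §3 The window from a satellite entry, every prime -/

/-- **THE VIRTUAL WINDOW FROM A SATELLITE ENTRY, every prime** (module docstring §3). [OURS] [cite: Hauser2010, §§F–G]
[cite: CossartJannsenSaito2020, Thm. 3.14] -/
theorem virtual_window_false_at_prime (p : ℕ) [Fact p.Prime] [CharP K p] {d : ℕ} (hdp : d + 1 = p) (hd2 : 2 ≤ d)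
    {eu ef : ℕ} (hef : eu + ef = d - 2) {la mu u f : Fin 4} (hlm : la ≠ mu) (hlu : la ≠ u) (hlf : la ≠ f) (hmu : mu ≠ u) (hmf : mu ≠ f) (huf : u ≠ f)
    {c : ℕ → State K} {j : ℕ → Fin 4} {b : ℕ → Fin 4 → K} (hw : FreeTail.IsWitnessedChain p c j b) {k Nc T : ℕ}
    (hT : 4 * (d - 1) + 2 ≤ T) (hisoR : ∀ t, t ≤ T + 1 → IsIsolated p (c (k + t)).F)
    (hcert : ∀ t, t ≤ T + 1 → originIdeal K ^ Nc ≤ singLocusIdeal p (c (k + t)).F ⊔ originIdeal K ^ (Nc + 1))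
    (hoR : ∀ t, t ≤ T + 1 → ordZero (c (k + t)).F = ((d + 2 : ℕ) : ℕ∞))
    (he3R : ∀ t, t ≤ T + 1 → Module.finrank K (ResCone.resVertex (c (k + t))) = 3)
    (hwtR : ∀ t, t ≤ T + 1 → (∀ i, (c (k + t)).r i ≤ 1) ∧ (c (k + t)).r.degree = 2)
    (hdivR : ∀ t, t ≤ T + 1 → ∀ e ∈ (c (k + t)).F.support, (c (k + t)).r ≤ e)
    {π₀ : Equiv.Perm (Fin 4)} {B₀ : State K} {M N : ℕ} (hM : Nc + 2 * p + 2 + p * (T + 1) ≤ M) (hN : d + 4 + d * (T + 1) ≤ N)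
    (hrel0 : ∃ (θ e : Fin 4 → MvPolynomial (Fin 4) K) (U E : MvPolynomial (Fin 4) K),
      θ (π₀ la) = X la * e la ∧ θ (π₀ mu) = X mu * e mu ∧ constantCoeff (e la) ≠ 0 ∧ constantCoeff (e mu) ≠ 0 ∧
      constantCoeff (θ (π₀ u)) = 0 ∧ constantCoeff (θ (π₀ f)) = 0 ∧
      coeff (Finsupp.single u 1) (θ (π₀ u)) * coeff (Finsupp.single f 1) (θ (π₀ f)) -
        coeff (Finsupp.single f 1) (θ (π₀ u)) * coeff (Finsupp.single u 1) (θ (π₀ f)) ≠ 0 ∧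
      constantCoeff U ≠ 0 ∧ E ∈ originIdeal K ^ M ∧ B₀.F = deletePthPowers p (U ^ p * aeval θ (c k).F) + E)
    (hrA0 : (c k).r = Finsupp.single (π₀ la) 1 + Finsupp.single (π₀ mu) 1)
    (hfr0 : ordZero B₀.F = ((d + 2 : ℕ) : ℕ∞) ∧ B₀.r = Finsupp.single la 1 + Finsupp.single mu 1 ∧
      (∀ e ∈ B₀.F.support, B₀.r ≤ e) ∧ (∃ a : K, a ≠ 0 ∧ ResCone.resForm B₀ = C a * X f ^ d) ∧
      (∀ e ∈ B₀.F.support, e f ≤ d - 1 → 2 ≤ e la ∧ 2 ≤ e mu) ∧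
      (∀ e ∈ B₀.F.support, e.degree < N → ¬ (e u = eu ∧ e f = ef)) ∧
      coeff (B₀.r + (Finsupp.single la 1 + Finsupp.single mu 1 + Finsupp.single u (eu + 1) + Finsupp.single f ef)) B₀.F ≠ 0 ∧
      IsIsolated p B₀.F ∧ Module.finrank K (ResCone.resVertex B₀) = 3)
    (hstart : j k = π₀ la ∨ (j k ≠ π₀ la ∧ j k ≠ π₀ mu ∧ b k (π₀ la) ≠ 0)) (hsat : FreeTail.IsSatellite j b k) :
    False := by
  obtain ⟨πs, Bs, ℓs, hπ0, hB0, hBs, hℓs, hπs⟩ := exists_virtual_data_prime p j b k la mu π₀ B₀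
  subst hπ0 hB0
  have hπlm : πs 0 la ≠ πs 0 mu := fun h => hlm ((πs 0).injective h)
  -- the first virtual chart is `λ`, and `πs 1 λ` is the newest real letter `j k`
  have hx0 : ℓs 0 = la := by
    rw [hℓs 0, Nat.add_zero]
    rcases hstart with h | ⟨h1, h2, h3⟩
    · rw [if_pos h]
    · rw [if_neg h1, if_neg h2, if_pos h3]
  have hπ1 : πs 1 la = j k := by
    rw [hπs 0, Nat.add_zero]
    rcases hstart with h | ⟨h1, h2, -⟩
    · rw [if_pos (Or.inl h), h]
    · rw [if_neg (not_or.mpr ⟨h1, h2⟩), hx0, Equiv.trans_apply, Equiv.swap_apply_left, Equiv.apply_symm_apply]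
  -- the satellite step `k + 1` charts the other slot: `ℓs 1 = μ`
  have hx1 : ℓs 1 = mu := by
    obtain ⟨hne, hb0⟩ := hsat
    rw [hℓs 1, hπ1, if_neg hne]
    by_cases h : j (k + 1) = πs 1 mu
    · rw [if_pos h]
    · rw [if_neg h, if_neg (not_not.mpr hb0)]
  exact virtual_window_false_of_entry_prime p hdp hd2 hef hlm hlu hlf hmu hmf huf hw hT hisoR hcert hoR he3R hwtR hdivR hBs hℓs
    hπs hM hN hrel0 hrA0 hfr0 hx0 hx1

/-! ## §4 The light-pair power-cone killer with rotations, modulo the entry, every prime -/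

/-- **THE LIGHT-PAIR POWER-CONE CONFIGURATION WITH ROTATIONS IS IMPOSSIBLE — MODULO THE ENTRY `hE`, every prime** (module
docstring §4): an isolated above-floor `Step0 p` chain with `x^{r₀} ∣ F₀`, shade `d` (`d + 1 = p`, `2 ≤ d`) and `e_G = 3` from
`k₀`, weights `≤ 1` of total `2`, witnessed (rotations allowed), gives `False` once, beyond every index, some time `k` carries a
framed virtual partner of `c k` along some `π₀` for every precision `M` and jet `N`.  Route: satellite time `s ≥ k` (free-tail
lemma `FreeTailProof.noIsolatedFreeTailAt_self (p)`), W5 `virtual_iterate_prime` from `k` to `s`, then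
`virtual_window_false_at_prime` at `s` (naming `λ ↔ μ` by which slot the step at `s` re-creates, W1a
`step_cases_of_weights_prime`). [OURS] [cite: Hauser2010, §§F–G] [cite: CossartJannsenSaito2020, Thm. 3.14] -/
theorem cInf_no_chain_of_entry_prime (p : ℕ) [Fact p.Prime] [CharP K p] {d : ℕ} (hdp : d + 1 = p) (hd2 : 2 ≤ d)
    {c : ℕ → State K} {j : ℕ → Fin 4} {b : ℕ → Fin 4 → K}
    (hc : ∀ k, IsIsolated p (c k).F ∧ Step0 p (c k) (c (k + 1))) (hw : FreeTail.IsWitnessedChain p c j b)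
    (hr0 : ∀ e ∈ (c 0).F.support, (c 0).r ≤ e) (hfloor : ∀ k, ordZero (c k).F ≠ (p : ℕ)) {k₀ : ℕ}
    (hshade : ∀ k, k₀ ≤ k → (c k).shade = ((d : ℕ) : ℕ∞))
    (he3 : ∀ k, k₀ ≤ k → Module.finrank K (ResCone.resVertex (c k)) = 3)
    (hwt : ∀ k, k₀ ≤ k → (∀ i, (c k).r i ≤ 1) ∧ (c k).r.degree = 2)
    (hE : ∀ k₂, ∃ k, k₂ ≤ k ∧ ∃ (la mu u f : Fin 4) (π₀ : Equiv.Perm (Fin 4)) (eu ef : ℕ),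
      la ≠ mu ∧ la ≠ u ∧ la ≠ f ∧ mu ≠ u ∧ mu ≠ f ∧ u ≠ f ∧ eu + ef = d - 2 ∧
      (c k).r = Finsupp.single (π₀ la) 1 + Finsupp.single (π₀ mu) 1 ∧
      ∀ M N : ℕ, ∃ B₀ : State K,
        (∃ (θ e : Fin 4 → MvPolynomial (Fin 4) K) (U E : MvPolynomial (Fin 4) K),
          θ (π₀ la) = X la * e la ∧ θ (π₀ mu) = X mu * e mu ∧ constantCoeff (e la) ≠ 0 ∧ constantCoeff (e mu) ≠ 0 ∧
          constantCoeff (θ (π₀ u)) = 0 ∧ constantCoeff (θ (π₀ f)) = 0 ∧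
          coeff (Finsupp.single u 1) (θ (π₀ u)) * coeff (Finsupp.single f 1) (θ (π₀ f)) -
            coeff (Finsupp.single f 1) (θ (π₀ u)) * coeff (Finsupp.single u 1) (θ (π₀ f)) ≠ 0 ∧
          constantCoeff U ≠ 0 ∧ E ∈ originIdeal K ^ M ∧ B₀.F = deletePthPowers p (U ^ p * aeval θ (c k).F) + E) ∧
        ordZero B₀.F = ((d + 2 : ℕ) : ℕ∞) ∧ B₀.r = Finsupp.single la 1 + Finsupp.single mu 1 ∧
        (∀ e ∈ B₀.F.support, B₀.r ≤ e) ∧ (∃ a : K, a ≠ 0 ∧ ResCone.resForm B₀ = C a * X f ^ d) ∧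
        (∀ e ∈ B₀.F.support, e f ≤ d - 1 → 2 ≤ e la ∧ 2 ≤ e mu) ∧
        (∀ e ∈ B₀.F.support, e.degree < N → ¬ (e u = eu ∧ e f = ef)) ∧
        coeff (B₀.r + (Finsupp.single la 1 + Finsupp.single mu 1 + Finsupp.single u (eu + 1) + Finsupp.single f ef)) B₀.F ≠ 0 ∧
        IsIsolated p B₀.F ∧ Module.finrank K (ResCone.resVertex B₀) = 3) : False := by
  obtain ⟨k, hk, la, mu, u, f, π₀, eu, ef, hlm, hlu, hlf, hmu, hmf, huf, hef, hrA0, hB⟩ := hE k₀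
  -- the window length of the game
  set Tw : ℕ := 4 * (d - 1) + 2 with hTw
  -- global regime facts
  have hiso : ∀ k, IsIsolated p (c k).F := fun k => (hc k).1
  have ho6 : ∀ m, k₀ ≤ m → ordZero (c m).F = ((d + 2 : ℕ) : ℕ∞) := fun m hm => by
    obtain ⟨o, ho, -, -, hod⟩ := ResCone.chain_shade_nat p hc hfloor hshade hm
    rw [(hwt m hm).2] at hod
    have h6 : o = d + 2 := by omega
    rw [ho, h6]
  have hdiv : ∀ m, ∀ e ∈ (c m).F.support, (c m).r ≤ e := IsolatedBand.isolated_chain_forall_le hc hr0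
  -- a satellite time `s = k + T`
  obtain ⟨s, hks, hsat⟩ := (FreeTail.satelliteRecurrenceAt_iff_noIsolatedFreeTailAt p p).mpr
    (FreeTailProof.noIsolatedFreeTailAt_self p) K c j b hw hiso k
  obtain ⟨T, rfl⟩ : ∃ T, s = k + T := ⟨s - k, by omega⟩
  -- a common certificate on `c k, …, c (k + T + Tw + 1)`, the budgets, the entry and the virtual data
  obtain ⟨Nc, hcert⟩ := exists_common_cert_prime p (T := T + (Tw + 1)) (fun t _ => hiso (k + t))
  obtain ⟨B₀, hrel0, hfr0⟩ := hB (Nc + 2 * p + 2 + p * (Tw + 1) + p * T) (d + 4 + d * (Tw + 1) + d * T)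
  obtain ⟨πs, Bs, ℓs, hπ0, hB0, hBs, hℓs, hπs⟩ := exists_virtual_data_prime p j b k la mu π₀ B₀
  subst hπ0 hB0
  -- phase 1: iterate to the satellite time
  obtain ⟨hrelT, hrAT, hfrT⟩ := virtual_iterate_prime p hdp hd2 hef hlm hlu hlf hmu hmf huf hw (T := T) (fun t _ => hiso (k + t))
    (fun t ht => hcert t (by omega)) (fun t _ => ho6 (k + t) (by omega)) (fun t _ => he3 (k + t) (by omega))
    (fun t _ => hwt (k + t) (by omega)) (fun t _ => hdiv (k + t)) hBs hℓs hπs (by omega) (by omega) hrel0 hrA0 hfr0 T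
    le_rfl
  -- phase 2 inputs at the base `k + T`
  have hcertW : ∀ t, t ≤ Tw + 1 → originIdeal K ^ Nc ≤ singLocusIdeal p (c (k + T + t)).F ⊔ originIdeal K ^ (Nc + 1) :=
    fun t ht => by rw [Nat.add_assoc]; exact hcert (T + t) (by omega)
  have hisoW : ∀ t, t ≤ Tw + 1 → IsIsolated p (c (k + T + t)).F := fun t _ => hiso _
  have hoW : ∀ t, t ≤ Tw + 1 → ordZero (c (k + T + t)).F = ((d + 2 : ℕ) : ℕ∞) := fun t _ => ho6 _ (by omega)
  have he3W : ∀ t, t ≤ Tw + 1 → Module.finrank K (ResCone.resVertex (c (k + T + t))) = 3 := fun t _ => he3 _ (by omega)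
  have hwtW : ∀ t, t ≤ Tw + 1 → (∀ i, (c (k + T + t)).r i ≤ 1) ∧ (c (k + T + t)).r.degree = 2 :=
    fun t _ => hwt _ (by omega)
  have hdivW : ∀ t, t ≤ Tw + 1 → ∀ e ∈ (c (k + T + t)).F.support, (c (k + T + t)).r ≤ e := fun t _ => hdiv _
  have hM : Nc + 2 * p + 2 + p * (Tw + 1) ≤ Nc + 2 * p + 2 + p * (Tw + 1) + p * T - p * T := by omega
  have hN : d + 4 + d * (Tw + 1) ≤ d + 4 + d * (Tw + 1) + d * T - d * T := by omega
  -- the swapped-orientation copies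
  obtain ⟨θ, e, U, E, h1, h2, h3, h4, h5, h6, h7, h8, h9, h10⟩ := hrelT
  obtain ⟨hoT, hrT, hdivT, hformT, hledT, hrowT, hVT, hisoT, he3T⟩ := hfrT
  have hrelS : ∃ (θ e : Fin 4 → MvPolynomial (Fin 4) K) (U E : MvPolynomial (Fin 4) K),
      θ (πs T mu) = X mu * e mu ∧ θ (πs T la) = X la * e la ∧ constantCoeff (e mu) ≠ 0 ∧ constantCoeff (e la) ≠ 0 ∧
      constantCoeff (θ (πs T u)) = 0 ∧ constantCoeff (θ (πs T f)) = 0 ∧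
      coeff (Finsupp.single u 1) (θ (πs T u)) * coeff (Finsupp.single f 1) (θ (πs T f)) -
        coeff (Finsupp.single f 1) (θ (πs T u)) * coeff (Finsupp.single u 1) (θ (πs T f)) ≠ 0 ∧
      constantCoeff U ≠ 0 ∧ E ∈ originIdeal K ^ (Nc + 2 * p + 2 + p * (Tw + 1) + p * T - p * T) ∧
      (Bs T).F = deletePthPowers p (U ^ p * aeval θ (c (k + T)).F) + E :=
    ⟨θ, e, U, E, h2, h1, h4, h3, h5, h6, h7, h8, h9, h10⟩
  have hrAS : (c (k + T)).r = Finsupp.single (πs T mu) 1 + Finsupp.single (πs T la) 1 := by rw [hrAT, add_comm]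
  have hfrS : ordZero (Bs T).F = ((d + 2 : ℕ) : ℕ∞) ∧ (Bs T).r = Finsupp.single mu 1 + Finsupp.single la 1 ∧
      (∀ e ∈ (Bs T).F.support, (Bs T).r ≤ e) ∧ (∃ a : K, a ≠ 0 ∧ ResCone.resForm (Bs T) = C a * X f ^ d) ∧
      (∀ e ∈ (Bs T).F.support, e f ≤ d - 1 → 2 ≤ e mu ∧ 2 ≤ e la) ∧
      (∀ e ∈ (Bs T).F.support, e.degree < d + 4 + d * (Tw + 1) + d * T - d * T → ¬ (e u = eu ∧ e f = ef)) ∧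
      coeff ((Bs T).r + (Finsupp.single mu 1 + Finsupp.single la 1 + Finsupp.single u (eu + 1) + Finsupp.single f ef)) (Bs T).F ≠ 0 ∧
      IsIsolated p (Bs T).F ∧ Module.finrank K (ResCone.resVertex (Bs T)) = 3 := by
    refine ⟨hoT, by rw [hrT, add_comm], hdivT, hformT, fun e he hf => (hledT e he hf).symm, hrowT, ?_, hisoT, he3T⟩
    rw [add_comm (Finsupp.single mu 1) (Finsupp.single la 1)]; exact hVT
  -- which slot does the step at `k + T` re-create?
  have hdp2 : d + 2 = p + 1 := by omega
  have hπlm : πs T la ≠ πs T mu := fun h => hlm ((πs T).injective h)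
  have hπlu : πs T la ≠ πs T u := fun h => hlu ((πs T).injective h)
  have hπlf : πs T la ≠ πs T f := fun h => hlf ((πs T).injective h)
  have hπmu : πs T mu ≠ πs T u := fun h => hmu ((πs T).injective h)
  have hπmf : πs T mu ≠ πs T f := fun h => hmf ((πs T).injective h)
  have hπuf : πs T u ≠ πs T f := fun h => huf ((πs T).injective h)
  obtain ⟨-, -, -, -, hcs⟩ := hw (k + T)
  have hw1' : ∀ i, (CentreBlowup.step p Finset.univ (j (k + T)) (b (k + T)) (c (k + T))).r i ≤ 1 := fun i => by
    rw [← hcs]; exact (hwt (k + T + 1) (by omega)).1 i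
  have hdeg' : (CentreBlowup.step p Finset.univ (j (k + T)) (b (k + T)) (c (k + T))).r.degree = 2 := by
    rw [← hcs]; exact (hwt (k + T + 1) (by omega)).2
  have hoT1 : ordZero (c (k + T)).F = ((p + 1 : ℕ) : ℕ∞) := by rw [ho6 (k + T) (by omega), hdp2]
  rcases step_cases_of_weights_prime p hπlm hπlu hπlf hπmu hπmf hπuf hrAT hoT1 hw1' hdeg' with
    ⟨hjr, -, -⟩ | ⟨hjr, -, -⟩ | ⟨hjr, hrot⟩
  · exact virtual_window_false_at_prime p hdp hd2 hef hlm hlu hlf hmu hmf huf hw le_rfl hisoW hcertW hoW he3W hwtW hdivW hM hN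
      ⟨θ, e, U, E, h1, h2, h3, h4, h5, h6, h7, h8, h9, h10⟩ hrAT ⟨hoT, hrT, hdivT, hformT, hledT, hrowT, hVT, hisoT, he3T⟩
      (Or.inl hjr) hsat
  · exact virtual_window_false_at_prime p hdp hd2 hef hlm.symm hmu hmf hlu hlf huf hw le_rfl hisoW hcertW hoW he3W hwtW hdivW hM
      hN hrelS hrAS hfrS (Or.inl hjr) hsat
  · have hjl : j (k + T) ≠ πs T la := by rcases hjr with h | h <;> rw [h] <;> [exact hπlu.symm; exact hπlf.symm]
    have hjm : j (k + T) ≠ πs T mu := by rcases hjr with h | h <;> rw [h] <;> [exact hπmu.symm; exact hπmf.symm]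
    rcases hrot with ⟨hbla, -, -⟩ | ⟨hbmu, -, -⟩
    · exact virtual_window_false_at_prime p hdp hd2 hef hlm hlu hlf hmu hmf huf hw le_rfl hisoW hcertW hoW he3W hwtW hdivW hM hN
        ⟨θ, e, U, E, h1, h2, h3, h4, h5, h6, h7, h8, h9, h10⟩ hrAT ⟨hoT, hrT, hdivT, hformT, hledT, hrowT, hVT, hisoT, he3T⟩
        (Or.inr ⟨hjl, hjm, hbla⟩) hsat
    · exact virtual_window_false_at_prime p hdp hd2 hef hlm.symm hmu hmf hlu hlf huf hw le_rfl hisoW hcertW hoW he3W hwtW hdivW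
        hM hN hrelS hrAS hfrS (Or.inr ⟨hjm, hjl, hbmu⟩) hsat

end SwapTransport

end Summit.ResolutionOfSingularities.ResolutionOfSingularities.Theorems.PIDim4

end
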